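import Mathlib
import Literature.Probability.RandomPlanarGeometry.ChordalCurveFamily

/-!
# Tightness of stub S4b (`stub_similarityConjugateRigidity`) of line `isotropy-kills-beltrami`
# (crux stmt-CriticalPhenomena-0698, `CardyRotToConfR2SymmetryUpgrade`) — drefute certificates

S4b: a plane homeomorphism `Φ` all of whose conjugates `Φ ∘ S ∘ Φ⁻¹` of orientation-preserving similarities
`S z = c z + w` are (anti)similarities is itself an (anti)similarity.  TRUE (paper proof in
`Drefute-isotropy-kills-beltrami.md`), and its proof uses only the conjugates of the translations and of the quarter
turn `z ↦ i z`.  The two theorems below certify that neither family can be dropped: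

* `s4b_false_realScalesOnly` — with the hypothesis for all REAL scale factors `c` (all dilations and the half turn)
  and all translations, the conclusion fails: the horizontal stretch `x + iy ↦ 2x + iy` conjugates `z ↦ c z + w`
  (`c` real) to `z ↦ c z + (stretch w)`; so a NON-REAL rotation is load-bearing ("isotropy kills Beltrami");
* `s4b_false_noTranslations` — with the hypothesis for all `c ∈ ℂ ∖ {0}` but `w = 0` (all rotations and dilations
  about the origin), the conclusion fails: `z ↦ |z| z` conjugates `z ↦ c z` to `z ↦ |c| c z`; so translations are
  load-bearing.
-/

noncomputable section

open Literature.Probability.RandomPlanarGeometry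

namespace Summit.CriticalPhenomena.CardyFormulaZ2.Cruxes.CardyRotToConfR2SymmetryUpgrade.DrefuteS4b

/-- S4b with the hypothesis restricted to real scale factors (and all translations). [folklore] -/
def S4bRealScalesOnly : Prop :=
  ∀ Φ : ℂ ≃ₜ ℂ,
    (∀ (c : ℝ) (hc : (c : ℂ) ≠ 0) (w : ℂ), ∃ (c' : ℂ) (hc' : c' ≠ 0) (w' : ℂ),
      Φ.symm.trans ((similarity c hc w).trans Φ) = similarity c' hc' w' ∨
      Φ.symm.trans ((similarity c hc w).trans Φ) =
        Complex.conjLIE.toHomeomorph.trans (similarity c' hc' w')) →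
    ∃ (c : ℂ) (hc : c ≠ 0) (w : ℂ), Φ = similarity c hc w ∨
      Φ = Complex.conjLIE.toHomeomorph.trans (similarity c hc w)

/-- S4b with the hypothesis restricted to similarities fixing the origin (no translations). [folklore] -/
def S4bNoTranslations : Prop :=
  ∀ Φ : ℂ ≃ₜ ℂ,
    (∀ (c : ℂ) (hc : c ≠ 0), ∃ (c' : ℂ) (hc' : c' ≠ 0) (w' : ℂ),
      Φ.symm.trans ((similarity c hc 0).trans Φ) = similarity c' hc' w' ∨
      Φ.symm.trans ((similarity c hc 0).trans Φ) =
        Complex.conjLIE.toHomeomorph.trans (similarity c' hc' w')) →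
    ∃ (c : ℂ) (hc : c ≠ 0) (w : ℂ), Φ = similarity c hc w ∨
      Φ = Complex.conjLIE.toHomeomorph.trans (similarity c hc w)

/-! ### Witness 1: the horizontal stretch -/

/-- The horizontal stretch `x + iy ↦ 2x + iy`, i.e. `z ↦ z + re z`, a real-linear homeomorphism. [folklore] -/
def stretch : ℂ ≃ₜ ℂ where
  toFun z := z + (z.re : ℂ)
  invFun z := z - ((z.re / 2 : ℝ) : ℂ)
  left_inv z := Complex.ext (by simp) (by simp)
  right_inv z := Complex.ext (by simp; ring) (by simp)
  continuous_toFun := by fun_prop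
  continuous_invFun := by fun_prop

theorem stretch_apply (z : ℂ) : stretch z = z + (z.re : ℂ) := rfl

/-- The stretch is real-affine-compatible: `stretch (c u + w) = c · stretch u + stretch w` for real `c`. [folklore] -/
theorem stretch_real_affine (c : ℝ) (u w : ℂ) :
    stretch ((c : ℂ) * u + w) = (c : ℂ) * stretch u + stretch w :=
  Complex.ext (by simp [stretch_apply]; ring) (by simp [stretch_apply])

/-- Conjugating `z ↦ c z + w` (`c` real) by the stretch gives `z ↦ c z + stretch w`. [folklore] -/
theorem stretch_conj_similarity (c : ℝ) (hc : (c : ℂ) ≠ 0) (w : ℂ) :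
    stretch.symm.trans ((similarity c hc w).trans stretch) = similarity c hc (stretch w) := by
  refine Homeomorph.ext fun z => ?_
  change stretch (similarity (c : ℂ) hc w (stretch.symm z)) = similarity (c : ℂ) hc (stretch w) z
  rw [similarity_apply, similarity_apply, stretch_real_affine, Homeomorph.apply_symm_apply]

theorem conj_trans_similarity_apply (c : ℂ) (hc : c ≠ 0) (w z : ℂ) :
    Complex.conjLIE.toHomeomorph.trans (similarity c hc w) z = c * (starRingEnd ℂ) z + w := rfl

/-- The stretch is not an (anti)similarity (it fixes `0` and `i` and sends `1 ↦ 2`). [folklore] -/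
theorem stretch_not_antiSimilarity :
    ¬ ∃ (c : ℂ) (hc : c ≠ 0) (w : ℂ), stretch = similarity c hc w ∨
      stretch = Complex.conjLIE.toHomeomorph.trans (similarity c hc w) := by
  rintro ⟨c, hc, w, h | h⟩
  · have hz : ∀ z : ℂ, z + (z.re : ℂ) = c * z + w := fun z => by
      simpa [stretch_apply, similarity_apply] using congrArg (fun f : ℂ ≃ₜ ℂ => f z) h
    have h0 := hz 0
    have h1 := hz 1
    have hI := hz Complex.I
    simp only [Complex.zero_re, Complex.ofReal_zero, add_zero, mul_zero, zero_add] at h0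
    simp only [Complex.one_re, Complex.ofReal_one, mul_one] at h1
    simp only [Complex.I_re, Complex.ofReal_zero, add_zero] at hI
    -- h0 : 0 = w ; h1 : 1 + 1 = c + w ; hI : I = c * I + w
    have hw : w = 0 := h0.symm
    have hc2 : c = 2 := by linear_combination -h1 - hw
    rw [hw, hc2, add_zero] at hI
    have := congrArg Complex.im hI
    norm_num at this
  · have hz : ∀ z : ℂ, z + (z.re : ℂ) = c * (starRingEnd ℂ) z + w := fun z => by
      simpa [stretch_apply, conj_trans_similarity_apply] using congrArg (fun f : ℂ ≃ₜ ℂ => f z) h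
    have h0 := hz 0
    have h1 := hz 1
    have hI := hz Complex.I
    simp only [Complex.zero_re, Complex.ofReal_zero, add_zero, map_zero, mul_zero, zero_add] at h0
    simp only [Complex.one_re, Complex.ofReal_one, map_one, mul_one] at h1
    simp only [Complex.I_re, Complex.ofReal_zero, add_zero, Complex.conj_I, mul_neg] at hI
    have hw : w = 0 := h0.symm
    have hc2 : c = 2 := by linear_combination -h1 - hw
    rw [hw, hc2, add_zero] at hI
    have := congrArg Complex.im hI
    norm_num at this

/-- **Tightness 1.** S4b is FALSE when only real scale factors are conjugated: a non-real rotation is load-bearing.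
[folklore] -/
theorem s4b_false_realScalesOnly : ¬ S4bRealScalesOnly := fun h =>
  stretch_not_antiSimilarity
    (h stretch fun c hc w => ⟨c, hc, stretch w, Or.inl (stretch_conj_similarity c hc w)⟩)

/-! ### Witness 2: the radial square `z ↦ |z| z` -/

/-- `(√a)⁻¹ * a = √a` (also at `a ≤ 0`, where both sides vanish or by the junk conventions). [folklore] -/
theorem inv_sqrt_mul_self (a : ℝ) : (Real.sqrt a)⁻¹ * a = Real.sqrt a := by
  rw [inv_mul_eq_div, Real.div_sqrt]

/-- Norm of `(√‖w‖)⁻¹ · w` is `√‖w‖`. [folklore] -/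
theorem norm_invSqrt_mul (w : ℂ) : ‖(((Real.sqrt ‖w‖)⁻¹ : ℝ) : ℂ) * w‖ = Real.sqrt ‖w‖ := by
  rw [norm_mul, Complex.norm_real, Real.norm_eq_abs, abs_inv, abs_of_nonneg (Real.sqrt_nonneg _),
    inv_sqrt_mul_self]

/-- The radial square `z ↦ |z| · z`, a homeomorphism of the plane with inverse `w ↦ w / √|w|`. [folklore] -/
def radialSq : ℂ ≃ₜ ℂ where
  toFun z := (‖z‖ : ℂ) * z
  invFun w := (((Real.sqrt ‖w‖)⁻¹ : ℝ) : ℂ) * w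
  left_inv z := by
    rcases eq_or_ne z 0 with rfl | hz
    · simp
    · have hn : ‖(‖z‖ : ℂ) * z‖ = ‖z‖ ^ 2 := by
        rw [norm_mul, Complex.norm_real, Real.norm_eq_abs, abs_norm, sq]
      change (((Real.sqrt ‖(‖z‖ : ℂ) * z‖)⁻¹ : ℝ) : ℂ) * ((‖z‖ : ℂ) * z) = z
      rw [hn, Real.sqrt_sq (norm_nonneg z), ← mul_assoc, ← Complex.ofReal_mul,
        inv_mul_cancel₀ (norm_ne_zero_iff.2 hz), Complex.ofReal_one, one_mul]
  right_inv w := by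
    rcases eq_or_ne w 0 with rfl | hw
    · simp
    · have hs : Real.sqrt ‖w‖ ≠ 0 := Real.sqrt_ne_zero'.2 (norm_pos_iff.2 hw)
      change (‖(((Real.sqrt ‖w‖)⁻¹ : ℝ) : ℂ) * w‖ : ℂ) * ((((Real.sqrt ‖w‖)⁻¹ : ℝ) : ℂ) * w) = w
      rw [norm_invSqrt_mul, ← mul_assoc, ← Complex.ofReal_mul, mul_inv_cancel₀ hs, Complex.ofReal_one,
        one_mul]
  continuous_toFun := by fun_prop
  continuous_invFun := by
    refine continuous_iff_continuousAt.2 fun w => ?_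
    rcases eq_or_ne w 0 with rfl | hw
    · rw [ContinuousAt, mul_zero, tendsto_zero_iff_norm_tendsto_zero]
      simp_rw [norm_invSqrt_mul]
      have h : ContinuousAt (fun w : ℂ => Real.sqrt ‖w‖) (0 : ℂ) :=
        (Real.continuous_sqrt.comp continuous_norm).continuousAt
      simpa [ContinuousAt] using h
    · have hs : Real.sqrt ‖w‖ ≠ 0 := Real.sqrt_ne_zero'.2 (norm_pos_iff.2 hw)
      have h1 : ContinuousAt (fun w : ℂ => (Real.sqrt ‖w‖)⁻¹) w :=
        ((Real.continuous_sqrt.comp continuous_norm).continuousAt).inv₀ hs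
      exact (Complex.continuous_ofReal.continuousAt.comp h1).mul continuousAt_id

theorem radialSq_apply (z : ℂ) : radialSq z = (‖z‖ : ℂ) * z := rfl

/-- `radialSq (c u) = |c| c · radialSq u`. [folklore] -/
theorem radialSq_mul (c u : ℂ) : radialSq (c * u) = (‖c‖ : ℂ) * c * radialSq u := by
  simp only [radialSq_apply, norm_mul, Complex.ofReal_mul]
  ring

/-- Conjugating `z ↦ c z` by the radial square gives the similarity `z ↦ |c| c z`. [folklore] -/
theorem radialSq_conj_similarity (c : ℂ) (hc : c ≠ 0) :
    radialSq.symm.trans ((similarity c hc 0).trans radialSq) =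
      similarity ((‖c‖ : ℂ) * c)
        (mul_ne_zero (Complex.ofReal_ne_zero.2 (norm_ne_zero_iff.2 hc)) hc) 0 := by
  refine Homeomorph.ext fun z => ?_
  change radialSq (similarity c hc 0 (radialSq.symm z)) = _
  rw [similarity_apply, add_zero, radialSq_mul, Homeomorph.apply_symm_apply, similarity_apply, add_zero]

/-- The radial square is not an (anti)similarity (it fixes `0` and `1` and sends `2 ↦ 4`). [folklore] -/
theorem radialSq_not_antiSimilarity :
    ¬ ∃ (c : ℂ) (hc : c ≠ 0) (w : ℂ), radialSq = similarity c hc w ∨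
      radialSq = Complex.conjLIE.toHomeomorph.trans (similarity c hc w) := by
  rintro ⟨c, hc, w, h | h⟩
  · have hz : ∀ z : ℂ, (‖z‖ : ℂ) * z = c * z + w := fun z => by
      simpa [radialSq_apply, similarity_apply] using congrArg (fun f : ℂ ≃ₜ ℂ => f z) h
    have h0 := hz 0
    have h1 := hz 1
    have h2 := hz 2
    simp only [mul_zero, zero_add] at h0
    rw [norm_one, Complex.ofReal_one, mul_one, mul_one] at h1
    rw [Complex.norm_two, Complex.ofReal_ofNat] at h2
    have hw : w = 0 := h0.symm
    have hc1 : c = 1 := by linear_combination -h1 - hw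
    rw [hw, hc1] at h2
    norm_num at h2
  · have hz : ∀ z : ℂ, (‖z‖ : ℂ) * z = c * (starRingEnd ℂ) z + w := fun z => by
      simpa [radialSq_apply, conj_trans_similarity_apply] using congrArg (fun f : ℂ ≃ₜ ℂ => f z) h
    have h0 := hz 0
    have h1 := hz 1
    have h2 := hz 2
    simp only [mul_zero, map_zero, zero_add] at h0
    rw [norm_one, Complex.ofReal_one, mul_one, map_one, mul_one] at h1
    rw [Complex.norm_two, Complex.ofReal_ofNat, map_ofNat] at h2
    have hw : w = 0 := h0.symm
    have hc1 : c = 1 := by linear_combination -h1 - hw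
    rw [hw, hc1] at h2
    norm_num at h2

/-- **Tightness 2.** S4b is FALSE when only the similarities fixing the origin are conjugated: translations are
load-bearing. [folklore] -/
theorem s4b_false_noTranslations : ¬ S4bNoTranslations := fun h =>
  radialSq_not_antiSimilarity
    (h radialSq fun c hc => ⟨(‖c‖ : ℂ) * c,
      mul_ne_zero (Complex.ofReal_ne_zero.2 (norm_ne_zero_iff.2 hc)) hc, 0,
      Or.inl (radialSq_conj_similarity c hc)⟩)

end Summit.CriticalPhenomena.CardyFormulaZ2.Cruxes.CardyRotToConfR2SymmetryUpgrade.DrefuteS4b
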